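import Mathlib
import Summits.NavierStokesRegularity.NavierStokesRegularity.Theorems.EulerZoomLiouvillePowerGaugeEulerLiouvilleHoopCapHardyTools
import HarnessLib

/-!
# Hoop core — t54-CAP part 2: the cap Hardy bounds on the end discs (`EndFluxHardy`, `AxialRayHardy`, `RadialRayHardy`)

Sub-problem `NavierStokesRegularity`, crux `PowerGaugeEulerLiouville` (a crux CLASS of self-similar Euler/NS strata on the MODEL lattice —
not NS regularity, not E).  Seat ns-ezl-w3 g7, tag t54-CAP part 2 (nsreg-p2 g41 ROUND-51 «THE CAPS COME FOR FREE» §1, `r51/Sketch51.lean`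
3a26356e4f98d965; texts `NsregP2.R51.EndFluxHardy` / `AxialRayHardy` / `RadialRayHardy` VERBATIM over the tree's `HoopCore.discEnergy`
(`…HoopRunFreeDefs`, LEAD g15) and `HoopCore.intervalHardy_of_hasDerivAt` (`…HoopIntervalHardy`, LEAD g15); tools in `…HoopCapHardyTools`).
Class-free, `C¹`.

Every end-disc functional of the net axis law is a `dt dθ = dA/‖z‖`-weighted disc integral, so the one-dimensional Hardy inequality with
end-point term applied RAY BY RAY (`t ↦ axisPt σ t θ`, `d/dt = DV·R_θe₀`, `(∂_t⟪V,R_θe₀⟫)² + (∂_tV_z)² ≤ ‖DV·R_θe₀‖² ≤ |DV|_F²`) and polar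
coordinates on the disc give

* `endFluxHardy`   — `endFlux V σ T₀ ≤ 4πT₀·⟨V_r² + V_z²⟩_θ(σ,T₀) + 2T₀·discEnergy V σ T₀`;
* `axialRayHardy`  — `∫₀^{T₀}⟨(k + V_z)²⟩_θ(σ,t) dt ≤ 2T₀·⟨(k + V_z)²⟩_θ(σ,T₀) + (T₀/π)·discEnergy V σ T₀` (any constant `k`);
* `radialRayHardy` — `∫₀^{T₀}⟨V_r²⟩_θ(σ,t) dt ≤ 2T₀·⟨V_r²⟩_θ(σ,T₀) + (T₀/π)·discEnergy V σ T₀`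

(only the WALL CIRCLE and the disc's own Dirichlet energy appear — no value of `V` inside the disc; no logarithmic divergence).
WHAT THIS IS NOT: not NS, not E — class-free calculus on discs; 19832 OPEN; NS regularity NOT proved.  [nsreg-p2 g41 ROUND-51 §1; folklore (Hardy)]
-/

noncomputable section

open MeasureTheory Set Metric Real Function WithLp intervalIntegral
open scoped InnerProductSpace RealInnerProductSpace Interval

set_option linter.dupNamespace false

namespace Summit.NavierStokesRegularity.NavierStokesRegularity.Theorems.PowerGaugeEulerLiouville.HoopCore

open Literature.Analysis Literature.Analysis.FluidPDE

/-! ## §4 The three cap bounds -/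

/-- **END-FLUX HARDY BOUND** (`NsregP2.R51.EndFluxHardy`, text verbatim): for `C¹` `V` and `T₀ > 0`,
`endFlux V σ T₀ ≤ 4πT₀·⟨V_r² + V_z²⟩_θ(σ,T₀) + 2T₀·discEnergy V σ T₀` — the end-disc flux of the hoop inequality is paid by the wall
circle and the disc's own Dirichlet energy. [nsreg-p2 g41 ROUND-51 §1; folklore (Hardy)] -/
theorem endFluxHardy :
    ∀ (V : EuclideanSpace ℝ (Fin 3) → EuclideanSpace ℝ (Fin 3)) (σ T₀ : ℝ), 0 < T₀ → ContDiff ℝ 1 V →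
      endFlux V σ T₀
        ≤ 4 * Real.pi * T₀ * circleAvg (fun y => radialVelocity V y ^ 2 + axialVelocity V y ^ 2) σ T₀
          + 2 * T₀ * discEnergy V σ T₀ := by
  intro V σ T₀ hT₀ hV
  have hVc : Continuous V := hV.continuous
  have hVd : Differentiable ℝ V := hV.differentiable one_ne_zero
  have h2π : (0 : ℝ) ≤ 2 * π := by positivity
  -- opaque names for the two ray components and their radial derivatives
  obtain ⟨a, ha⟩ : ∃ a : ℝ → ℝ → ℝ,
      a = fun t θ => ⟪V (axisPt σ t θ), rotZ θ (EuclideanSpace.single (0 : Fin 3) (1 : ℝ))⟫ := ⟨_, rfl⟩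
  obtain ⟨a', ha'⟩ : ∃ a' : ℝ → ℝ → ℝ, a' = fun t θ =>
      ⟪fderiv ℝ V (axisPt σ t θ) (rotZ θ (EuclideanSpace.single (0 : Fin 3) (1 : ℝ))),
        rotZ θ (EuclideanSpace.single (0 : Fin 3) (1 : ℝ))⟫ := ⟨_, rfl⟩
  obtain ⟨c, hc⟩ : ∃ c : ℝ → ℝ → ℝ, c = fun t θ => axialVelocity V (axisPt σ t θ) := ⟨_, rfl⟩
  obtain ⟨c', hc'⟩ : ∃ c' : ℝ → ℝ → ℝ, c' = fun t θ =>
      ⟪fderiv ℝ V (axisPt σ t θ) (rotZ θ (EuclideanSpace.single (0 : Fin 3) (1 : ℝ))), eZ⟫ := ⟨_, rfl⟩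
  have hA : Continuous (uncurry a) := by rw [ha]; exact (continuous_rayData hV σ).1
  have hA' : Continuous (uncurry a') := by rw [ha']; exact (continuous_rayData hV σ).2.1
  have hC : Continuous (uncurry c) := by rw [hc]; exact (continuous_rayData hV σ).2.2.1
  have hC' : Continuous (uncurry c') := by rw [hc']; exact (continuous_rayData hV σ).2.2.2
  have hda : ∀ θ t, HasDerivAt (fun t => a t θ) (a' t θ) t := by
    intro θ t; rw [ha, ha']; exact hasDerivAt_sliceA_radius hVd σ t θ
  have hdc : ∀ θ t, HasDerivAt (fun t => c t θ) (c' t θ) t := by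
    intro θ t; rw [hc, hc']; exact hasDerivAt_sliceC_radius hVd σ t θ
  -- Hardy on each family of rays
  have hHa := ray_hardy_integrated hA hA' hda hT₀
  have hHc := ray_hardy_integrated hC hC' hdc hT₀
  -- the derivative energies are dominated by the disc energy
  have i1 : ∀ θ, IntervalIntegrable (fun t => t * a' t θ ^ 2) volume 0 T₀ := fun θ =>
    (continuous_of_uncurry_right (continuous_uncurry_fst_mul (continuous_uncurry_sq hA')) θ).intervalIntegrable _ _
  have i2 : ∀ θ, IntervalIntegrable (fun t => t * c' t θ ^ 2) volume 0 T₀ := fun θ =>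
    (continuous_of_uncurry_right (continuous_uncurry_fst_mul (continuous_uncurry_sq hC')) θ).intervalIntegrable _ _
  have j1 : IntervalIntegrable (fun θ => ∫ t in (0 : ℝ)..T₀, t * a' t θ ^ 2) volume 0 (2 * π) :=
    (continuous_intervalIntegral_of_uncurry (continuous_uncurry_fst_mul (continuous_uncurry_sq hA')) 0 T₀).intervalIntegrable _ _
  have j2 : IntervalIntegrable (fun θ => ∫ t in (0 : ℝ)..T₀, t * c' t θ ^ 2) volume 0 (2 * π) :=
    (continuous_intervalIntegral_of_uncurry (continuous_uncurry_fst_mul (continuous_uncurry_sq hC')) 0 T₀).intervalIntegrable _ _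
  have hdom : (∫ θ in (0 : ℝ)..2 * π, ∫ t in (0 : ℝ)..T₀, t * a' t θ ^ 2)
      + (∫ θ in (0 : ℝ)..2 * π, ∫ t in (0 : ℝ)..T₀, t * c' t θ ^ 2) ≤ discEnergy V σ T₀ := by
    have hsum : (∫ θ in (0 : ℝ)..2 * π, ∫ t in (0 : ℝ)..T₀, t * a' t θ ^ 2)
        + (∫ θ in (0 : ℝ)..2 * π, ∫ t in (0 : ℝ)..T₀, t * c' t θ ^ 2)
        = ∫ θ in (0 : ℝ)..2 * π, ∫ t in (0 : ℝ)..T₀, (t * a' t θ ^ 2 + t * c' t θ ^ 2) := by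
      rw [← intervalIntegral.integral_add j1 j2]
      exact intervalIntegral.integral_congr fun θ _ => (intervalIntegral.integral_add (i1 θ) (i2 θ)).symm
    rw [hsum]
    refine integral_integral_le_discEnergy hV σ hT₀.le
      (continuous_uncurry_add (continuous_uncurry_fst_mul (continuous_uncurry_sq hA'))
        (continuous_uncurry_fst_mul (continuous_uncurry_sq hC'))) fun t ht θ => ?_
    have h := radialEntries_sq_le_frobeniusNormSq (fderiv ℝ V (axisPt σ t θ)) θ
    have ht0 : 0 ≤ t := ht.1
    simp only [ha', hc']
    nlinarith [mul_le_mul_of_nonneg_left h ht0]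
  -- the end flux in the chart, angle outside
  have k1 : ∀ θ, IntervalIntegrable (fun t => a t θ ^ 2) volume 0 T₀ := fun θ =>
    (continuous_of_uncurry_right (continuous_uncurry_sq hA) θ).intervalIntegrable _ _
  have k2 : ∀ θ, IntervalIntegrable (fun t => c t θ ^ 2) volume 0 T₀ := fun θ =>
    (continuous_of_uncurry_right (continuous_uncurry_sq hC) θ).intervalIntegrable _ _
  have l1 : IntervalIntegrable (fun θ => ∫ t in (0 : ℝ)..T₀, a t θ ^ 2) volume 0 (2 * π) :=
    (continuous_intervalIntegral_of_uncurry (continuous_uncurry_sq hA) 0 T₀).intervalIntegrable _ _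
  have l2 : IntervalIntegrable (fun θ => ∫ t in (0 : ℝ)..T₀, c t θ ^ 2) volume 0 (2 * π) :=
    (continuous_intervalIntegral_of_uncurry (continuous_uncurry_sq hC) 0 T₀).intervalIntegrable _ _
  have hflux : endFlux V σ T₀ = (∫ θ in (0 : ℝ)..2 * π, ∫ t in (0 : ℝ)..T₀, a t θ ^ 2)
      + ∫ θ in (0 : ℝ)..2 * π, ∫ t in (0 : ℝ)..T₀, c t θ ^ 2 := by
    rw [endFlux_eq hVc σ hT₀]
    have h1 : ∫ t in (0 : ℝ)..T₀, ∫ θ in (0 : ℝ)..2 * π,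
        (radialVelocity V (axisPt σ t θ) ^ 2 + axialVelocity V (axisPt σ t θ) ^ 2)
        = ∫ t in (0 : ℝ)..T₀, ∫ θ in (0 : ℝ)..2 * π, (a t θ ^ 2 + c t θ ^ 2) := by
      refine intervalIntegral.integral_congr_ae (ae_of_all _ fun t ht => ?_)
      rw [uIoc_of_le hT₀.le] at ht
      refine intervalIntegral.integral_congr fun θ _ => ?_
      simp only [ha, hc]
      rw [inner_rotZ_single_zero_eq_radialVelocity V σ ht.1 θ]
    rw [h1, intervalIntegral_swap_continuous (continuous_uncurry_add (continuous_uncurry_sq hA) (continuous_uncurry_sq hC))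
      hT₀.le h2π, ← intervalIntegral.integral_add l1 l2]
    exact intervalIntegral.integral_congr fun θ _ => intervalIntegral.integral_add (k1 θ) (k2 θ)
  -- the wall circle
  have m1 : IntervalIntegrable (fun θ => a T₀ θ ^ 2) volume 0 (2 * π) :=
    ((continuous_of_uncurry_left hA T₀).fun_pow 2).intervalIntegrable _ _
  have m2 : IntervalIntegrable (fun θ => c T₀ θ ^ 2) volume 0 (2 * π) :=
    ((continuous_of_uncurry_left hC T₀).fun_pow 2).intervalIntegrable _ _
  have hwall : (∫ θ in (0 : ℝ)..2 * π, a T₀ θ ^ 2) + (∫ θ in (0 : ℝ)..2 * π, c T₀ θ ^ 2)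
      = 2 * Real.pi * circleAvg (fun y => radialVelocity V y ^ 2 + axialVelocity V y ^ 2) σ T₀ := by
    unfold circleAvg
    rw [← mul_assoc, mul_one_div_cancel (by positivity : (2 : ℝ) * Real.pi ≠ 0), one_mul,
      ← intervalIntegral.integral_add m1 m2]
    refine intervalIntegral.integral_congr fun θ _ => ?_
    simp only [ha, hc]
    rw [inner_rotZ_single_zero_eq_radialVelocity V σ hT₀ θ]
  -- assemble
  rw [hflux]
  have hT2 : (0 : ℝ) ≤ 2 * T₀ := by positivity
  have p1 := mul_le_mul_of_nonneg_left hdom hT2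
  have p2 : 2 * T₀ * ((∫ θ in (0 : ℝ)..2 * π, a T₀ θ ^ 2) + ∫ θ in (0 : ℝ)..2 * π, c T₀ θ ^ 2)
      = 2 * T₀ * (2 * Real.pi * circleAvg (fun y => radialVelocity V y ^ 2 + axialVelocity V y ^ 2) σ T₀) := by
    rw [hwall]
  linarith [hHa, hHc, p1, p2]

/-- **AXIAL RAY HARDY BOUND with a constant shift `k`** (`NsregP2.R51.AxialRayHardy`, text verbatim; `k + V_z` covers
`W_z = γ(σ − c₂) + V_z` on the disc at height `σ`): for `C¹` `V` and `T₀ > 0`,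
`∫₀^{T₀} ⟨(k + V_z)²⟩_θ(σ,t) dt ≤ 2T₀·⟨(k + V_z)²⟩_θ(σ,T₀) + (T₀/π)·discEnergy V σ T₀`. [nsreg-p2 g41 ROUND-51 §1; folklore (Hardy)] -/
theorem axialRayHardy :
    ∀ (V : EuclideanSpace ℝ (Fin 3) → EuclideanSpace ℝ (Fin 3)) (k σ T₀ : ℝ), 0 < T₀ → ContDiff ℝ 1 V →
      ∫ t in (0 : ℝ)..T₀, circleAvg (fun y => (k + axialVelocity V y) ^ 2) σ t
        ≤ 2 * T₀ * circleAvg (fun y => (k + axialVelocity V y) ^ 2) σ T₀ + T₀ / Real.pi * discEnergy V σ T₀ := by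
  intro V k σ T₀ hT₀ hV
  have hVd : Differentiable ℝ V := hV.differentiable one_ne_zero
  obtain ⟨G, hG⟩ : ∃ G : ℝ → ℝ → ℝ, G = fun t θ => k + axialVelocity V (axisPt σ t θ) := ⟨_, rfl⟩
  obtain ⟨c', hc'⟩ : ∃ c' : ℝ → ℝ → ℝ, c' = fun t θ =>
      ⟪fderiv ℝ V (axisPt σ t θ) (rotZ θ (EuclideanSpace.single (0 : Fin 3) (1 : ℝ))), eZ⟫ := ⟨_, rfl⟩
  have hGc : Continuous (uncurry G) := by
    rw [hG]; exact continuous_uncurry_const_add (continuous_rayData hV σ).2.2.1 k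
  have hC' : Continuous (uncurry c') := by rw [hc']; exact (continuous_rayData hV σ).2.2.2
  have hdG : ∀ θ t, HasDerivAt (fun t => G t θ) (c' t θ) t := by
    intro θ t; rw [hG, hc']; exact (hasDerivAt_sliceC_radius hVd σ t θ).const_add k
  have hle : ∀ t θ, c' t θ ^ 2 ≤ frobeniusNormSq (fderiv ℝ V (axisPt σ t θ)) := fun t θ => by
    have h := radialEntries_sq_le_frobeniusNormSq (fderiv ℝ V (axisPt σ t θ)) θ
    rw [hc']
    nlinarith [sq_nonneg ⟪fderiv ℝ V (axisPt σ t θ) (rotZ θ (EuclideanSpace.single (0 : Fin 3) (1 : ℝ))),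
      rotZ θ (EuclideanSpace.single (0 : Fin 3) (1 : ℝ))⟫]
  have hH := ray_hardy_avg hV σ hGc hC' hdG hT₀ hle
  -- chart forms of the two sides
  have hL : ∫ t in (0 : ℝ)..T₀, circleAvg (fun y => (k + axialVelocity V y) ^ 2) σ t
      = 1 / (2 * Real.pi) * ∫ θ in (0 : ℝ)..2 * π, ∫ t in (0 : ℝ)..T₀, G t θ ^ 2 := by
    rw [← intervalIntegral_swap_continuous (continuous_uncurry_sq hGc) hT₀.le (by positivity),
      ← intervalIntegral.integral_const_mul]
    refine intervalIntegral.integral_congr fun t _ => ?_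
    unfold circleAvg
    simp only [hG]
  have hW : circleAvg (fun y => (k + axialVelocity V y) ^ 2) σ T₀
      = 1 / (2 * Real.pi) * ∫ θ in (0 : ℝ)..2 * π, G T₀ θ ^ 2 := by
    unfold circleAvg
    simp only [hG]
  rw [hL, hW]
  exact hH

/-- **RADIAL RAY HARDY BOUND** (`NsregP2.R51.RadialRayHardy`, text verbatim; along each ray `t ↦ ⟪V(axisPt σ t θ), R_θe₀⟫` is `C¹`
on all of `ℝ` and equals `V_r(axisPt σ t θ)` for `t > 0` — the junk value of `radialVelocity` on the axis is invisible to the integrals):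
for `C¹` `V` and `T₀ > 0`, `∫₀^{T₀} ⟨V_r²⟩_θ(σ,t) dt ≤ 2T₀·⟨V_r²⟩_θ(σ,T₀) + (T₀/π)·discEnergy V σ T₀`. [nsreg-p2 g41 ROUND-51 §1; folklore (Hardy)] -/
theorem radialRayHardy :
    ∀ (V : EuclideanSpace ℝ (Fin 3) → EuclideanSpace ℝ (Fin 3)) (σ T₀ : ℝ), 0 < T₀ → ContDiff ℝ 1 V →
      ∫ t in (0 : ℝ)..T₀, circleAvg (fun y => radialVelocity V y ^ 2) σ t
        ≤ 2 * T₀ * circleAvg (fun y => radialVelocity V y ^ 2) σ T₀ + T₀ / Real.pi * discEnergy V σ T₀ := by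
  intro V σ T₀ hT₀ hV
  have hVd : Differentiable ℝ V := hV.differentiable one_ne_zero
  obtain ⟨a, ha⟩ : ∃ a : ℝ → ℝ → ℝ,
      a = fun t θ => ⟪V (axisPt σ t θ), rotZ θ (EuclideanSpace.single (0 : Fin 3) (1 : ℝ))⟫ := ⟨_, rfl⟩
  obtain ⟨a', ha'⟩ : ∃ a' : ℝ → ℝ → ℝ, a' = fun t θ =>
      ⟪fderiv ℝ V (axisPt σ t θ) (rotZ θ (EuclideanSpace.single (0 : Fin 3) (1 : ℝ))),
        rotZ θ (EuclideanSpace.single (0 : Fin 3) (1 : ℝ))⟫ := ⟨_, rfl⟩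
  have hA : Continuous (uncurry a) := by rw [ha]; exact (continuous_rayData hV σ).1
  have hA' : Continuous (uncurry a') := by rw [ha']; exact (continuous_rayData hV σ).2.1
  have hda : ∀ θ t, HasDerivAt (fun t => a t θ) (a' t θ) t := by
    intro θ t; rw [ha, ha']; exact hasDerivAt_sliceA_radius hVd σ t θ
  have hle : ∀ t θ, a' t θ ^ 2 ≤ frobeniusNormSq (fderiv ℝ V (axisPt σ t θ)) := fun t θ => by
    have h := radialEntries_sq_le_frobeniusNormSq (fderiv ℝ V (axisPt σ t θ)) θ
    rw [ha']
    nlinarith [sq_nonneg ⟪fderiv ℝ V (axisPt σ t θ) (rotZ θ (EuclideanSpace.single (0 : Fin 3) (1 : ℝ))), eZ⟫]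
  have hH := ray_hardy_avg hV σ hA hA' hda hT₀ hle
  -- chart forms (the integrands agree for `t > 0`, i.e. on `Ι 0 T₀`)
  have hL : ∫ t in (0 : ℝ)..T₀, circleAvg (fun y => radialVelocity V y ^ 2) σ t
      = 1 / (2 * Real.pi) * ∫ θ in (0 : ℝ)..2 * π, ∫ t in (0 : ℝ)..T₀, a t θ ^ 2 := by
    rw [← intervalIntegral_swap_continuous (continuous_uncurry_sq hA) hT₀.le (by positivity),
      ← intervalIntegral.integral_const_mul]
    refine intervalIntegral.integral_congr_ae (ae_of_all _ fun t ht => ?_)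
    rw [uIoc_of_le hT₀.le] at ht
    unfold circleAvg
    congr 1
    refine intervalIntegral.integral_congr fun θ _ => ?_
    simp only [ha]
    rw [inner_rotZ_single_zero_eq_radialVelocity V σ ht.1 θ]
  have hW : circleAvg (fun y => radialVelocity V y ^ 2) σ T₀ = 1 / (2 * Real.pi) * ∫ θ in (0 : ℝ)..2 * π, a T₀ θ ^ 2 := by
    unfold circleAvg
    congr 1
    refine intervalIntegral.integral_congr fun θ _ => ?_
    simp only [ha]
    rw [inner_rotZ_single_zero_eq_radialVelocity V σ hT₀ θ]
  rw [hL, hW]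
  exact hH

end Summit.NavierStokesRegularity.NavierStokesRegularity.Theorems.PowerGaugeEulerLiouville.HoopCore

end
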